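import Summits.AtomisticToContinuum.HydrodynamicLimit.Theorems.StiffCollisionalRelaxationAprioriBoundsFibreDefsR4
import HarnessLib

/-!
# Sketch for the crux idea `local-units-on-the-kinetic-box` (crux `AprioriBounds`, stmt-AtomisticToContinuum-14827;
round 2, ideator 4)

Planner material, kernel-checked, NOT a skeleton.  It types the objects of the card over the tree's vocabulary and proves
the two elementary lemmas the card calls "provable now":

* §1 block fields at a kernel, LOCAL THERMAL UNITS, the local-unit tail fraction `locFrac`, the kinetic box `InBox`
  (shape of `GermanoSplitLES.KineticRangeControl`'s box, stmt-9201);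
* §2 `local_level_of_abs_level` (pointwise) and `frac_le_locFrac_of_box` (configuration level): inside the box an
  ABSOLUTE tail level `K ≥ 4U²` is a LOCAL level `K/(4Θ)` — deterministic, PROVED;
* §3 `EqLocalTailSuperExp` — the card's single equilibrium-only open input E1_loc, typed: under the INVARIANT homogeneous
  law, a sustained (time-integrated over `[0,t]`) excess of the local-unit tail fraction at a FIXED level `K`, while the
  box holds, is super-exponentially rare (`≤ e^{-M(N+1)}` for every `M`, eventually in `N`);
  `LocalTailConcAt` — its transferred, non-equilibrium form (what the layer cake consumes);
* §4 `tendsto_zero_of_transfer` — PROVED: the landed static L² budget `TransferInequality` (stmt-9512,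
  `P(S)² ≤ e^{C(N+1)} G(S)`) turns every super-exponential equilibrium bound into `P_N(S_N) → 0` (the fixed-`C` form of
  (i) needs exactly `→ 0`, not a dial);
* §5 `ReductionShape` — the composition the line would certify (typed only): box on `[0,t]` at two admissible filters
  (both instances of stmt-9201) ∧ `FarTailAllAt` (stmt-14415 via landed glue) ∧ `LocalTailConcAt` ⟹ `PartOneAt`.
-/

noncomputable section

open MeasureTheory Filter Set Topology
open scoped ENNReal

namespace Summit.AtomisticToContinuum.HydrodynamicLimit.Cruxes.AprioriBounds.LocalUnitsKineticBox

open Literature.MathematicalPhysics.KineticTheory Literature.Analysis.FluidPDE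
open Summit.AtomisticToContinuum.HydrodynamicLimit.Theorems.VisitLedgerUpscattering (Cfg Flow Flows NiceProfiles)
open Summit.AtomisticToContinuum.HydrodynamicLimit.Theorems.FibreDeficitTransfer (frac frac_eq_avg FarTailAllAt)
open Summit.AtomisticToContinuum.HydrodynamicLimit.Theorems.AprioriBoundsNegative (PartOneAt)

/-! ## §1 Block fields at a kernel and local thermal units -/

variable {N : ℕ}

/-- Block density at `x` for the (shifted) kernel `χ`: `ρ̄(x) = (N+1)⁻¹ ∑ᵢ χ(xᵢ − x)`. -/
def bρ (χ : T3 → ℝ) (w : Cfg N) (x : T3) : ℝ := empiricalDensityField w (fun y => χ (y - x))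

/-- Block momentum at `x`: `m̄(x) = (N+1)⁻¹ ∑ᵢ χ(xᵢ − x) vᵢ`. -/
def bm (χ : T3 → ℝ) (w : Cfg N) (x : T3) : V3 := empiricalMomentumField w (fun y => χ (y - x))

/-- Block kinetic energy at `x`: `ē(x) = (N+1)⁻¹ ∑ᵢ χ(xᵢ − x) |vᵢ|²/2`. -/
def be (χ : T3 → ℝ) (w : Cfg N) (x : T3) : ℝ := empiricalEnergyField w (fun y => χ (y - x))

/-- Block mean velocity `ū = m̄/ρ̄` (junk `0`-scaled when `ρ̄ = 0`; the box excludes that). -/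
def bu (χ : T3 → ℝ) (w : Cfg N) (x : T3) : V3 := (bρ χ w x)⁻¹ • bm χ w x

/-- Block temperature `θ̄ = (2/3)(ē/ρ̄ − |ū|²/2)` (the KRC temperature). -/
def bθ (χ : T3 → ℝ) (w : Cfg N) (x : T3) : ℝ := 2 / 3 * (be χ w x / bρ χ w x - ‖bu χ w x‖ ^ 2 / 2)

/-- LOCAL-UNIT tail fraction at local level `K`: the fraction of spheres whose peculiar kinetic energy, measured in
units of the block temperature AT THEIR OWN POSITION, is at least `K`:
`locFrac_K(w) = (N+1)⁻¹ #{i | K·θ̄(xᵢ) ≤ |vᵢ − ū(xᵢ)|²}`.  A coherent jet or a hot spot is NOT fast in these units. -/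
def locFrac (χ : T3 → ℝ) (K : ℝ) (w : Cfg N) : ℝ :=
  ((N + 1 : ℕ) : ℝ)⁻¹ * ∑ i, if K * bθ χ w (w i).1 ≤ ‖(w i).2 - bu χ w (w i).1‖ ^ 2 then (1 : ℝ) else 0

/-- The kinetic box at kernel `χ` (shape of `GermanoSplitLES.KineticRangeControl`'s box `{c ≤ ρ ≤ C_ρ, |m| ≤ C,
E ≤ C, θ ≥ c}`, here at every point of the torus). -/
def InBox (χ : T3 → ℝ) (c Cρ C : ℝ) (w : Cfg N) : Prop :=
  ∀ x : T3, c ≤ bρ χ w x ∧ bρ χ w x ≤ Cρ ∧ ‖bm χ w x‖ ≤ C ∧ be χ w x ≤ C ∧ c ≤ bθ χ w x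

/-- Inside the box the block mean speed and temperature are capped: `|ū| ≤ C/c`, `θ̄ ≤ (2/3)(C/c)` (typed consequence;
the division bookkeeping is the prover's). -/
def BoxCaps (χ : T3 → ℝ) (U Θ : ℝ) (w : Cfg N) : Prop :=
  ∀ x : T3, ‖bu χ w x‖ ≤ U ∧ 0 ≤ bθ χ w x ∧ bθ χ w x ≤ Θ

/-! ## §2 Absolute levels are local levels inside the box (deterministic, proved) -/

/-- Pointwise: if `|u| ≤ U`, `0 ≤ θb ≤ Θ`, `0 < Θ`, `4U² ≤ K ≤ |v|²` then `(K/(4Θ))·θb ≤ |v − u|²`. -/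
theorem local_level_of_abs_level {v u : V3} {K U Θ θb : ℝ} (hU0 : 0 ≤ U) (hU : ‖u‖ ≤ U)
    (_hθ0 : 0 ≤ θb) (hθ : θb ≤ Θ) (hΘ : 0 < Θ) (hK : 4 * U ^ 2 ≤ K) (hv : K ≤ ‖v‖ ^ 2) :
    K / (4 * Θ) * θb ≤ ‖v - u‖ ^ 2 := by
  have hK0 : 0 ≤ K := le_trans (by positivity) hK
  have h1 : Real.sqrt K ≤ ‖v‖ := by
    rw [← Real.sqrt_sq (norm_nonneg v)]
    exact Real.sqrt_le_sqrt hv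
  have h2 : 2 * U ≤ Real.sqrt K := by
    rw [show (2 * U) = Real.sqrt ((2 * U) ^ 2) by rw [Real.sqrt_sq (by positivity)]]
    exact Real.sqrt_le_sqrt (by nlinarith)
  have h3 : Real.sqrt K / 2 ≤ ‖v - u‖ := by
    have := norm_sub_norm_le v u
    linarith
  have h4 : K / 4 ≤ ‖v - u‖ ^ 2 := by
    have h5 : (Real.sqrt K / 2) ^ 2 ≤ ‖v - u‖ ^ 2 := pow_le_pow_left₀ (by positivity) h3 2
    have h6 : (Real.sqrt K / 2) ^ 2 = K / 4 := by rw [div_pow, Real.sq_sqrt hK0]; ring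
    linarith [h5, h6]
  have h7 : K / (4 * Θ) * θb ≤ K / 4 := by
    have h8 : K / (4 * Θ) * θb ≤ K / (4 * Θ) * Θ := mul_le_mul_of_nonneg_left hθ (by positivity)
    calc K / (4 * Θ) * θb ≤ K / (4 * Θ) * Θ := h8
      _ = K / 4 := by field_simp
  linarith

/-- Configuration level: inside the box (caps `U, Θ`), for every absolute level `K ≥ 4U²`,
`frac_K(w) ≤ locFrac_{K/(4Θ)}(w)` — the absolute tail fraction is dominated by a LOCAL-UNIT tail fraction. -/
theorem frac_le_locFrac_of_box (χ : T3 → ℝ) {U Θ K : ℝ} (hU0 : 0 ≤ U) (hΘ : 0 < Θ) (hK : 4 * U ^ 2 ≤ K)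
    (w : Cfg N) (hbox : BoxCaps χ U Θ w) :
    frac K w ≤ locFrac χ (K / (4 * Θ)) w := by
  rw [frac_eq_avg, locFrac]
  refine mul_le_mul_of_nonneg_left (Finset.sum_le_sum fun i _ => ?_) (by positivity)
  by_cases h : K ≤ ‖(w i).2‖ ^ 2
  · obtain ⟨hu, hθ0, hθ⟩ := hbox (w i).1
    rw [if_pos h, if_pos (local_level_of_abs_level hU0 hu hθ0 hθ hΘ hK h)]
  · rw [if_neg h]
    split_ifs <;> norm_num

/-! ## §3 The equilibrium-only open input E1_loc and its transferred form -/

/-- Admissible kernel family at filter exponent `γ'` (the kernel clause of the crux's (ii), with `γ'` in place of `γ`;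
admissible for `GermanoSplitLES.KineticRangeControl` for every `γ' < 1/3`). -/
def AdmissibleKernels (γ' C : ℝ) (φ : ℕ → T3 → ℝ) : Prop :=
  (∀ N, Literature.Analysis.FunctionSpaces.Torus.IsSmooth (φ N)) ∧ (∀ N y, 0 ≤ φ N y) ∧ (∀ N, ∫ y, φ N y = 1) ∧
    (∀ (N : ℕ) y, ((N : ℝ) + 1) ^ (-γ') ≤ Torus.euclidDist y 0 → φ N y = 0) ∧
    (∀ (N : ℕ) y, φ N y ≤ C * ((N : ℝ) + 1) ^ (3 * γ')) ∧
    (∀ (N : ℕ) y, ‖Literature.Analysis.FunctionSpaces.Torus.gradient (φ N) y‖ ≤ C * ((N : ℝ) + 1) ^ (4 * γ'))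

/-- **E1_loc (`EqLocalTailSuperExp`) — the card's ONE open input, EQUILIBRIUM ONLY.**  Under the invariant homogeneous
hard-sphere Gibbs law `G_N = localGibbsLaw σ 1 0 θe N (Φ N)`, for every admissible kernel family at a filter exponent
`γ' ∈ (1/6, 1/3)`, every box, every sub-Gaussian envelope exponent `a < 1/2` there is `A` such that for every horizon
`t > 0`, every FIXED local level `K` and every `M`, eventually in `N`:
`G_N{ box on [0,t] ∧ t·A·e^{−aK} < ∫₀ᵗ locFrac_K(Φ_s z) ds } ≤ e^{−M(N+1)}`.
A statement about the stationary, reversible, explicit law only (no profiles, no PDE, no non-equilibrium object);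
the `K`-before-`N` order keeps the level-`K` population EXTENSIVE, the only regime where the upkeep count
(`≍ N e^{−K/2} · σ²(N+1)^{1/3} t ≫ N` collision refreshes) makes a sustained excess space-TIME extensive. -/
def EqLocalTailSuperExp (σ θe : ℝ) (Φ : Flows σ) : Prop :=
  ∀ (γ' Ck : ℝ) (φ : ℕ → T3 → ℝ), 1 / 6 < γ' → γ' < 1 / 3 → AdmissibleKernels γ' Ck φ →
    ∀ (c Cρ C : ℝ), 0 < c → ∀ a : ℝ, 0 < a → a < 1 / 2 → ∃ A : ℝ, ∀ (t K : ℝ), 0 < t → ∀ M : ℝ,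
      ∀ᶠ N : ℕ in atTop,
        localGibbsLaw σ (fun _ => 1) (fun _ => 0) (fun _ => θe) N (Φ N)
            {z | (∀ s ∈ Icc 0 t, InBox (φ N) c Cρ C ((Φ N).flow s z)) ∧
              t * A * Real.exp (-(a * K)) < ∫ s in Icc 0 t, locFrac (φ N) K ((Φ N).flow s z)} ≤
          ENNReal.ofReal (Real.exp (-(M * ((N : ℝ) + 1))))

/-- **`LocalTailConcAt` — the transferred form along the NON-equilibrium law** (what the fixed-level layer cake consumes):
for the local Gibbs data `(a₀,u₀,θ₀)`, at every fixed local level `K`, the probability of a sustained local-unit tail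
excess inside the box tends to `0` (genuinely `→ 0`: the fixed-`C` form of (i) tolerates no `N`-uniform dial here). -/
def LocalTailConcAt (σ : ℝ) (a₀ θ₀ : T3 → ℝ) (u₀ : T3 → V3) (Φ : Flows σ) (t : ℝ)
    (φ : ℕ → T3 → ℝ) (c Cρ C : ℝ) : Prop :=
  ∀ a : ℝ, 0 < a → a < 1 / 2 → ∃ A : ℝ, ∀ K : ℝ,
    Tendsto (fun N : ℕ => localGibbsLaw σ a₀ u₀ θ₀ N (Φ N)
        {z | (∀ s ∈ Icc 0 t, InBox (φ N) c Cρ C ((Φ N).flow s z)) ∧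
          t * A * Real.exp (-(a * K)) < ∫ s in Icc 0 t, locFrac (φ N) K ((Φ N).flow s z)})
      atTop (𝓝 0)

/-! ## §4 Super-exponential equilibrium cost + the static L² budget ⟹ `→ 0` (proved) -/

/-- **Transfer squeeze.**  If `P N ^ 2 ≤ e^{C(N+1)} · G N` for all `N` (the landed `TransferInequality`, stmt-9512) and
`G N ≤ e^{−M(N+1)}` eventually for EVERY `M` (a super-exponential equilibrium bound), then `P N → 0`. -/
theorem tendsto_zero_of_transfer {P G : ℕ → ℝ≥0∞} (C : ℝ)
    (hdom : ∀ N, P N ^ 2 ≤ ENNReal.ofReal (Real.exp (C * ((N : ℝ) + 1))) * G N)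
    (hsup : ∀ M : ℝ, ∀ᶠ N in atTop, G N ≤ ENNReal.ofReal (Real.exp (-(M * ((N : ℝ) + 1))))) :
    Tendsto P atTop (𝓝 0) := by
  have hev : ∀ᶠ N : ℕ in atTop, P N ≤ ENNReal.ofReal (Real.exp (-((N : ℝ) + 1))) := by
    filter_upwards [hsup (C + 2)] with N hN
    have hsq : P N ^ 2 ≤ (ENNReal.ofReal (Real.exp (-((N : ℝ) + 1)))) ^ 2 := by
      calc P N ^ 2 ≤ ENNReal.ofReal (Real.exp (C * ((N : ℝ) + 1))) * G N := hdom N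
        _ ≤ ENNReal.ofReal (Real.exp (C * ((N : ℝ) + 1))) *
              ENNReal.ofReal (Real.exp (-((C + 2) * ((N : ℝ) + 1)))) := by gcongr
        _ = (ENNReal.ofReal (Real.exp (-((N : ℝ) + 1)))) ^ 2 := by
              rw [← ENNReal.ofReal_mul (Real.exp_pos _).le, ← Real.exp_add,
                ← ENNReal.ofReal_pow (Real.exp_pos _).le, ← Real.exp_nat_mul]
              congr 2
              push_cast
              ring
    exact (ENNReal.pow_le_pow_left_iff two_ne_zero).1 hsq
  have hlim : Tendsto (fun N : ℕ => ENNReal.ofReal (Real.exp (-((N : ℝ) + 1)))) atTop (𝓝 0) := by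
    rw [← ENNReal.ofReal_zero]
    refine ENNReal.tendsto_ofReal (Real.tendsto_exp_atBot.comp ?_)
    exact tendsto_neg_atTop_atBot.comp (tendsto_natCast_atTop_atTop.atTop_add tendsto_const_nhds)
  exact tendsto_of_tendsto_of_tendsto_of_le_of_le' tendsto_const_nhds hlim
    (Eventually.of_forall fun _ => bot_le) hev

/-! ## §5 The composition the line would certify (typed only; glue = box caps + §2 + fixed-level layer cake) -/

/-- `BoxAt` — the kinetic box holds on `[0,t]` w.h.p. at the kernel family `φ` (an instance of stmt-9201's conclusion
under the crux prefix, at ANY admissible filter). -/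
def BoxAt (σ : ℝ) (a₀ θ₀ : T3 → ℝ) (u₀ : T3 → V3) (Φ : Flows σ) (t : ℝ) (φ : ℕ → T3 → ℝ) (c Cρ C : ℝ) : Prop :=
  Tendsto (fun N : ℕ => localGibbsLaw σ a₀ u₀ θ₀ N (Φ N)
    {z | ¬ ∀ s ∈ Icc 0 t, InBox (φ N) c Cρ C ((Φ N).flow s z)}) atTop (𝓝 0)

/-- **`ReductionShape`** (the implication the skeleton's `AprioriBounds_of` would prove for component (i)): a box at an
admissible filter with `γ' ∈ (1/6,1/3)` on `[0,t]` w.h.p. (stmt-9201), far tails in the mean at all levels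
(`FarTailAllAt`, ⇐ stmt-14415, landed glue) and the transferred local-unit concentration at every fixed level
(`LocalTailConcAt` ⇐ `EqLocalTailSuperExp` + `TransferInequality` + §4) give `PartOneAt`.  Glue: on the box event,
`frac_K ≤ locFrac_{K/(4Θ)}` (§2) for `K ≥ 4U²`; unit-width layer cake over absolute levels with
`λ < a/(4Θ)`; levels `≤ L` by `LocalTailConcAt` (finitely many, each `→ 0`), levels `> L` by Markov on `FarTailAllAt`
with slack `η_K = K²e^{−K/2Θ'}` (uniform in `N`, `≤ tA/L`), and `Cexp := ∑_K e^{λ(K+1)}(envelope_K + η_K)` FIXED —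
then `limsup_N P_N ≤ tA/L` for every `L`, i.e. `→ 0`. -/
def ReductionShape (σ : ℝ) (a₀ θ₀ : T3 → ℝ) (u₀ : T3 → V3) (Φ : Flows σ) (t : ℝ) : Prop :=
  ∀ (γ' Ck : ℝ) (φ : ℕ → T3 → ℝ) (c Cρ C : ℝ), 1 / 6 < γ' → γ' < 1 / 3 → AdmissibleKernels γ' Ck φ → 0 < c →
    BoxAt σ a₀ θ₀ u₀ Φ t φ c Cρ C → FarTailAllAt σ a₀ θ₀ u₀ Φ t → LocalTailConcAt σ a₀ θ₀ u₀ Φ t φ c Cρ C →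
      PartOneAt σ a₀ θ₀ u₀ Φ t

end Summit.AtomisticToContinuum.HydrodynamicLimit.Cruxes.AprioriBounds.LocalUnitsKineticBox
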